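import Mathlib

/-!
# The order filtration on automorphisms `≡ id (mod r^a)` (engine 1's `W(f)` toy model, target T101 — an instrument, NOT a resolution theorem)

Hypothesis-free bookkeeping (F1)–(F3), (F5) of RE-DERIVATION-eng1-g43 §3.1 in abstract form: for a commutative ring `S` and an element `r`
(`σ` in the toy model, `S = k[σ][ε]`), an endomorphism `A` fixing `r` is *congruent to the identity modulo `r^a`* (`IsCong r a A`) when
`A y - y ∈ r^a S` for every `y`.  The ring automorphisms fixing `r` with `A ≡ id (mod r^a)` form a subgroup `level r a` of `RingAut S`, and
* (F1) `level r` is a descending chain (`level_antitone`);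
* (F2) `[level r a, level r b] ⊆ level r (a + b)` (`commutator_mem_level`) — via `α := A - id`, `α (r^b z) = r^b α z`, and
  `([A, B] - id) y = (AB - BA)(A⁻¹B⁻¹ y)`;
* (F3) to first order composition is addition: `(AB) y - y ≡ (A y - y) + (B y - y) (mod r^{2m})` on `level r m` (`mul_apply_sub`), hence
  `(A^n) y - y ≡ n (A y - y)` (`pow_apply_sub`);
* (F5) in characteristic `p`, `A ∈ level r m`, `m ≥ 1` ⇒ `A ^ p ∈ level r (m + 1)` (`pow_char_mem_level_succ`): the graded pieces are
  elementary abelian `p`-groups.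
These are exactly the hypotheses `hcomm` / `hexp` of the eigen-coset lifting lemma (`WeightedCentreEigenCosetLift`); the scalar action (F4) of the
torus `s_μ` is toy-model specific and is left to the instance.
-/

namespace Literature.AlgebraicGeometry.Resolution.WeightedBlowup.OrderFiltration

variable {S : Type*} [CommRing S]

/-- `A ≡ id (mod r^a)`: every `A y - y` is a multiple of `r ^ a`. [cite: Lang2002, Ch. II §1; AbramovichTemkinWlodarczyk2024, §5.1 (p. 1575)] -/
def IsCong (r : S) (a : ℕ) (A : S → S) : Prop :=
  ∀ y, ∃ z, A y = y + r ^ a * z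

/-- A congruence modulo `r^b` is one modulo `r^a` for `a ≤ b` (bookkeeping). [cite: Lang2002, Ch. II §1] -/
theorem IsCong.mono {r : S} {a b : ℕ} (hab : a ≤ b) {A : S → S} (h : IsCong r b A) : IsCong r a A := fun y => by
  obtain ⟨z, hz⟩ := h y
  exact ⟨r ^ (b - a) * z, by rw [hz, ← mul_assoc, ← pow_add, Nat.add_sub_cancel' hab]⟩

/-- Every map is `≡ id (mod r^0)`. [cite: Lang2002, Ch. II §1] -/
theorem IsCong.zero (r : S) (A : S → S) : IsCong r 0 A := fun y => ⟨A y - y, by ring⟩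

section ringHomClass

variable {F : Type*} [FunLike F S S] [RingHomClass F S S]

/-- (F1) composition stays at the same level. [cite: Lang2002, Ch. II §1] -/
theorem IsCong.comp {r : S} {a : ℕ} {A B : F} (hAr : A r = r) (hA : IsCong r a A) (hB : IsCong r a B) :
    IsCong r a (fun y => A (B y)) := fun y => by
  obtain ⟨z, hz⟩ := hB y
  obtain ⟨u, hu⟩ := hA y
  refine ⟨u + A z, ?_⟩
  show A (B y) = _
  rw [hz, map_add, map_mul, map_pow, hAr, hu]
  ring

/-- (F2), additive core: `A ≡ id (mod r^a)`, `B ≡ id (mod r^b)`, both fixing `r` ⇒ `AB - BA ≡ 0 (mod r^(a+b))`.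
[cite: Lang2002, Ch. II §1; AbramovichTemkinWlodarczyk2024, §5.1 (p. 1575)] -/
theorem IsCong.comm_sub {r : S} {a b : ℕ} {A B : F} (hAr : A r = r) (hBr : B r = r) (hA : IsCong r a A)
    (hB : IsCong r b B) (y : S) : ∃ v, A (B y) - B (A y) = r ^ (a + b) * v := by
  obtain ⟨z, hz⟩ := hB y
  obtain ⟨u, hu⟩ := hA y
  obtain ⟨v, hv⟩ := hA z
  obtain ⟨v', hv'⟩ := hB u
  refine ⟨v - v', ?_⟩
  have h1 : A (B y) = y + r ^ a * u + r ^ b * (z + r ^ a * v) := by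
    rw [hz, map_add, map_mul, map_pow, hAr, hu, hv]
  have h2 : B (A y) = y + r ^ b * z + r ^ a * (u + r ^ b * v') := by
    rw [hu, map_add, map_mul, map_pow, hBr, hz, hv']
  rw [h1, h2]
  ring

/-- (F3): to first order, composition is addition of the error terms. [cite: Lang2002, Ch. II §1] -/
theorem IsCong.comp_sub {r : S} {m : ℕ} {A B : F} (hAr : A r = r) (hA : IsCong r m A) (hB : IsCong r m B) (y : S) :
    ∃ v, A (B y) - y = (A y - y) + (B y - y) + r ^ (2 * m) * v := by
  obtain ⟨z, hz⟩ := hB y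
  obtain ⟨u, hu⟩ := hA y
  obtain ⟨v, hv⟩ := hA z
  refine ⟨v, ?_⟩
  have h1 : A (B y) = y + r ^ m * u + r ^ m * (z + r ^ m * v) := by
    rw [hz, map_add, map_mul, map_pow, hAr, hu, hv]
  rw [h1, hu, hz, two_mul, pow_add]
  ring

end ringHomClass

/-- An automorphism fixing `r` has inverse fixing `r` (bookkeeping). [cite: Lang2002, Ch. II §1] -/
theorem symm_apply_eq_self {r : S} {A : S ≃+* S} (h : A r = r) : A.symm r = r := by
  rw [RingEquiv.symm_apply_eq]
  exact h.symm

/-- (F1) the inverse stays at the same level. [cite: Lang2002, Ch. II §1] -/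
theorem IsCong.symm {r : S} {a : ℕ} {A : S ≃+* S} (hA : IsCong r a A) : IsCong r a A.symm := fun y => by
  obtain ⟨z, hz⟩ := hA (A.symm y)
  rw [RingEquiv.apply_symm_apply] at hz
  exact ⟨-z, by rw [mul_neg, ← sub_eq_add_neg, eq_sub_iff_add_eq]; exact hz.symm⟩

/-- The level-`a` subgroup `𝔄_a` of `RingAut S`: automorphisms fixing `r` with `A ≡ id (mod r^a)` ((F1) of RE-DERIVATION-eng1-g43 §3.1;
instrument for engine 1's `W(f)` toy model, NOT a resolution theorem). [cite: Lang2002, Ch. I §3, Ch. II §1; AbramovichTemkinWlodarczyk2024, §5.1 (p. 1575)] -/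
def level (r : S) (a : ℕ) : Subgroup (S ≃+* S) where
  carrier := {A | A r = r ∧ IsCong r a A}
  mul_mem' := by
    rintro A B ⟨hAr, hA⟩ ⟨hBr, hB⟩
    refine ⟨by rw [RingAut.mul_apply, hBr, hAr], fun y => ?_⟩
    obtain ⟨z, hz⟩ := (hA.comp hAr hB) y
    exact ⟨z, by rw [RingAut.mul_apply]; exact hz⟩
  one_mem' := ⟨rfl, fun y => ⟨0, by simp⟩⟩
  inv_mem' := by
    rintro A ⟨hAr, hA⟩
    refine ⟨by rw [RingAut.inv_apply]; exact symm_apply_eq_self hAr, fun y => ?_⟩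
    obtain ⟨z, hz⟩ := hA.symm y
    exact ⟨z, by rw [RingAut.inv_apply]; exact hz⟩

/-- Membership in `level r a` (bookkeeping). [cite: Lang2002, Ch. I §3] -/
theorem mem_level {r : S} {a : ℕ} {A : S ≃+* S} : A ∈ level r a ↔ A r = r ∧ IsCong r a A := Iff.rfl

/-- (F1) `level r` is a descending chain. [cite: Lang2002, Ch. I §3] -/
theorem level_antitone (r : S) : Antitone (level r) := fun _ _ hab _ hA => ⟨hA.1, hA.2.mono hab⟩

/-- `level r 0` is the group of all automorphisms fixing `r`. [cite: Lang2002, Ch. I §3] -/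
theorem mem_level_zero {r : S} {A : S ≃+* S} : A ∈ level r 0 ↔ A r = r :=
  ⟨fun h => h.1, fun h => ⟨h, IsCong.zero r A⟩⟩

/-- **(F2)** `[𝔄_a, 𝔄_b] ⊆ 𝔄_{a+b}`: the commutator of automorphisms `≡ id` modulo `r^a`, `r^b` is `≡ id (mod r^(a+b))`
(RE-DERIVATION-eng1-g43 §3.1 (F2); instrument, NOT a resolution theorem). [cite: Lang2002, Ch. I §3, Ch. II §1; AbramovichTemkinWlodarczyk2024, §5.1 (p. 1575)] -/
theorem commutator_mem_level {r : S} {a b : ℕ} {A B : S ≃+* S} (hA : A ∈ level r a) (hB : B ∈ level r b) :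
    A * B * A⁻¹ * B⁻¹ ∈ level r (a + b) := by
  have hAr' := symm_apply_eq_self hA.1
  have hBr' := symm_apply_eq_self hB.1
  refine ⟨by simp only [RingAut.mul_apply, RingAut.inv_apply, hAr', hBr', hA.1, hB.1], fun y => ?_⟩
  obtain ⟨v, hv⟩ := IsCong.comm_sub hA.1 hB.1 hA.2 hB.2 (A.symm (B.symm y))
  have hx : B (A (A.symm (B.symm y))) = y := by rw [A.apply_symm_apply, B.apply_symm_apply]
  refine ⟨v, ?_⟩
  show A (B (A.symm (B.symm y))) = _
  calc A (B (A.symm (B.symm y)))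
      = (A (B (A.symm (B.symm y))) - B (A (A.symm (B.symm y)))) + B (A (A.symm (B.symm y))) := by ring
    _ = y + r ^ (a + b) * v := by rw [hv, hx]; ring

/-- (F2) in the shape used by the eigen-coset lift: for `g ∈ 𝔄_1` and `n ∈ 𝔄_m`, `g n g⁻¹ n⁻¹ ∈ 𝔄_{m+1}`. [cite: Lang2002, Ch. I §3] -/
theorem commutator_mem_level_succ {r : S} {m : ℕ} {g n : S ≃+* S} (hg : g ∈ level r 1) (hn : n ∈ level r m) :
    g * n * g⁻¹ * n⁻¹ ∈ level r (m + 1) := by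
  rw [add_comm]
  exact commutator_mem_level hg hn

/-- **(F3)** on `𝔄_m`, composition is addition to first order: `(AB) y - y ≡ (A y - y) + (B y - y) (mod r^(2m))`
(RE-DERIVATION-eng1-g43 §3.1 (F3); instrument, NOT a resolution theorem). [cite: Lang2002, Ch. I §3, Ch. II §1; AbramovichTemkinWlodarczyk2024, §5.1 (p. 1575)] -/
theorem mul_apply_sub {r : S} {m : ℕ} {A B : S ≃+* S} (hA : A ∈ level r m) (hB : B ∈ level r m) (y : S) :
    ∃ v, (A * B) y - y = (A y - y) + (B y - y) + r ^ (2 * m) * v := by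
  obtain ⟨v, hv⟩ := IsCong.comp_sub hA.1 hA.2 hB.2 y
  exact ⟨v, by rw [RingAut.mul_apply]; exact hv⟩

/-- (F3) iterated: `(A^n) y - y ≡ n · (A y - y) (mod r^(2m))` for `A ∈ 𝔄_m`. [cite: Lang2002, Ch. I §3, Ch. II §1] -/
theorem pow_apply_sub {r : S} {m : ℕ} {A : S ≃+* S} (hA : A ∈ level r m) (n : ℕ) (y : S) :
    ∃ v, (A ^ n) y - y = n * (A y - y) + r ^ (2 * m) * v := by
  induction n with
  | zero => exact ⟨0, by simp⟩
  | succ n ih =>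
    obtain ⟨v, hv⟩ := ih
    obtain ⟨u, hu⟩ := hA.2 y
    obtain ⟨u', hu'⟩ := hA.2 u
    have h1 : A (A y - y) = (A y - y) + r ^ (2 * m) * u' := by
      rw [hu, add_sub_cancel_left, map_mul, map_pow, hA.1, hu', two_mul, pow_add]
      ring
    have hd : (A ^ n) y = y + (n * (A y - y) + r ^ (2 * m) * v) := sub_eq_iff_eq_add'.mp hv
    refine ⟨n * u' + A v, ?_⟩
    rw [pow_succ', RingAut.mul_apply, hd, map_add, map_add, map_mul, map_natCast, h1, map_mul, map_pow, hA.1]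
    push_cast
    ring

/-- **(F5)** in characteristic `p` the graded pieces `𝔄_m / 𝔄_{m+1}` (`m ≥ 1`) have exponent `p`: `A ∈ 𝔄_m ⇒ A^p ∈ 𝔄_{m+1}`
(RE-DERIVATION-eng1-g43 §3.1 (F3)/(F5); instrument, NOT a resolution theorem). [cite: Lang2002, Ch. I §6, Ch. II §1; AbramovichTemkinWlodarczyk2024, §5.1 (p. 1575)] -/
theorem pow_char_mem_level_succ {r : S} (p : ℕ) [CharP S p] {m : ℕ} (hm : 1 ≤ m) {A : S ≃+* S} (hA : A ∈ level r m) :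
    A ^ p ∈ level r (m + 1) := by
  refine ⟨((level r m).pow_mem hA p).1, fun y => ?_⟩
  obtain ⟨v, hv⟩ := pow_apply_sub hA p y
  rw [CharP.cast_eq_zero, zero_mul, zero_add] at hv
  refine ⟨r ^ (m - 1) * v, ?_⟩
  have h2 : m + 1 + (m - 1) = 2 * m := by omega
  rw [sub_eq_iff_eq_add'.mp hv, ← mul_assoc, ← pow_add, h2]

end Literature.AlgebraicGeometry.Resolution.WeightedBlowup.OrderFiltration
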